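import Literature.NumberTheory.Automorphic.UnitaryGroupAutomorphicRep   -- ★ `unitaryGroupOfForm`, `mem_unitaryGroupOfForm_iff`
import Literature.Analysis.Calculus.CayleyTransform                    -- ★ `cayley X = (1 − X)(1 + X)⁻¹`, `isUnit_cayley`, …
import Mathlib.LinearAlgebra.Matrix.NonsingularInverse
import Mathlib.Algebra.GroupWithZero.Units.Basic
import Mathlib.Algebra.Algebra.Bilinear
import HarnessLib

/-!
# Anti-homomorphisms and the Cayley transform; the form adjoint `θ_J(X) = J⁻¹ σ(X)ᵀ J` of a unitary group
# `U(σ, J) = {g : θ_J(g) g = 1}`, and `c(𝔲) ⊆ U(σ, J)`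

Topic `LinearAlgebra/Matrix`; namespace `Literature.LinearAlgebra.Matrix`. KERNEL mathematics only: theorems, no
definition, no named fact, no instance, no notation, no `sorry`.  Pure algebra over the tree's Cayley transform
★ `Literature.Analysis.Calculus.cayley` (`c(X) = (1 − X)(1 + X)⁻¹`, total via `Ring.inverse`), written for the cell
`pub/hodgecm-mathlib` (LEAD F0P3a-plan (g9) WORD T8-2 (2), brick «N6ns-chart-3», FILE 1 of 2): the σ-fixed restriction
of the regular orbit chart (★ `RegularOrbitChartProductNonarch`) to a unitary group `U(σ, J)` over a NON-archimedean
(indeed any) field uses `c` as chart map, because `c` is EQUIVARIANT for every additive anti-homomorphism `θ`: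
`θ(c X) = c(θ X)` and `c(X)⁻¹ = c(−X)`, hence `θ(c X) · c X = 1` whenever `θ X = −X`; i.e. `c` maps
`𝔲 = {X ∣ θ_J X = −X}` (where `1 ± X` are units) into `U(σ, J) = {g ∣ θ_J g · g = 1}` — for the archimedean group
`arch` this is ★ `UnitaryGroup.cayley_mem_arch`; here it is done for the tree's general `unitaryGroupOfForm σ J`
(any commutative coefficient ring, any `σ`, `J` with unit determinant), together with the two identities that make the
CONJUGATION chart `(X, Y) ↦ c(X) · γ c(Y) · c(X)⁻¹` restrict to `U(σ, J)`.

* §1 (any ring `R`; `θ : R → R` with `θ(xy) = θ(y)θ(x)`, `θ 1 = 1` (and additivity where needed) as HYPOTHESES):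
  `isUnit_map_of_antiHom`, `antiHom_ringInverse`, `antiHom_conj`; `cayley_mul_cayley_neg`, `cayley_neg_mul_cayley`,
  `ringInverse_cayley`, `ringInverse_cayley_neg` (`c(X)⁻¹ = c(−X)`), `commute_cayley` (torus rider: `c(Y)` commutes
  with what `Y` commutes with), `antiHom_cayley` (`θ(c x) = c(θ x)`), **`antiHom_cayley_mul_cayley`**
  (`θ x = −x ⇒ θ(c x) c x = 1`), and the two restriction identities **`antiHom_cayleyConj_mul_self`** (⇐: `x, y ∈ 𝔲`,
  `γ` unitary ⇒ `g = c(x) γ c(y) c(x)⁻¹` has `θ g · g = 1`) and **`cayleyConj_antiHom_eq_of_mul_self`** (⇒: if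
  `θ g · g = 1` then `g` is also the chart value at the REFLECTED parameters `(−θx, −θy)` — so chart injectivity
  forces `θ x = −x`, `θ y = −y`).
* §2 (matrices over a commutative ring `E`, `σ : E →+* E`, `J` with `IsUnit J.det`; `θ_J X := J⁻¹ * (X.map σ)ᵀ * J`
  inline): `formAdjoint_mul` ∕ `_one` ∕ `_add` ∕ `_sub`, **`mem_unitaryGroupOfForm_iff_formAdjoint_mul_eq_one`**,
  `exists_mem_unitaryGroupOfForm_coe_eq` (`θ_J W · W = 1 ⇒ W ∈ U`),
  `formAdjoint_coe_eq_coe_inv` (`θ_J γ = γ⁻¹` on `U`), **`formAdjoint_commutator_of_mem`** and the stability of the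
  commutant and of the slice of a unitary `γ`: **`formAdjoint_mem_ker_ad`**, **`formAdjoint_mem_range_ad`**;
  **`cayley_mem_unitaryGroupOfForm`** (`θ_J X = −X`, `1 ± X` units ⇒ `c X ∈ U(σ, J)`).

## References

* [Weyl1939] H. Weyl, *The Classical Groups*, Princeton (1939), Ch. II §10 (Cayley's rational parametrisation of
  the orthogonal ∕ unitary groups by their infinitesimal elements).
* [PlatonovRapinchuk1994] V. Platonov, A. Rapinchuk, *Algebraic Groups and Number Theory* (1994), §2.3 (unitary
  groups of hermitian forms), §3.1.
-/

set_option autoImplicit false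

open scoped Matrix

namespace Literature.LinearAlgebra.Matrix

/-! ### 1. Anti-homomorphisms and the Cayley transform in a ring -/

section Ring

open Literature.Analysis.Calculus

variable {R : Type*} [Ring R] (θ : R → R) (hθm : ∀ x y, θ (x * y) = θ y * θ x) (hθ1 : θ 1 = 1)

include hθm hθ1 in
/-- An anti-homomorphism maps units to units. [cite: Weyl1939, Ch. II §10] -/
theorem isUnit_map_of_antiHom {x : R} (hx : IsUnit x) : IsUnit (θ x) := by
  obtain ⟨u, rfl⟩ := hx
  exact ⟨⟨θ (u : R), θ ((u⁻¹ : Rˣ) : R), by rw [← hθm, Units.inv_mul, hθ1], by rw [← hθm, Units.mul_inv, hθ1]⟩, rfl⟩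

include hθm hθ1 in
/-- An anti-homomorphism commutes with `Ring.inverse` on units: `θ(x⁻¹) = θ(x)⁻¹`. [cite: Weyl1939, Ch. II §10] -/
theorem antiHom_ringInverse {x : R} (hx : IsUnit x) : θ (Ring.inverse x) = Ring.inverse (θ x) := by
  obtain ⟨u, rfl⟩ := hx
  let v : Rˣ := ⟨θ (u : R), θ ((u⁻¹ : Rˣ) : R), by rw [← hθm, Units.inv_mul, hθ1], by rw [← hθm, Units.mul_inv, hθ1]⟩
  rw [Ring.inverse_unit]
  change θ ((u⁻¹ : Rˣ) : R) = Ring.inverse (v : R)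
  rw [Ring.inverse_unit]
  rfl

include hθm hθ1 in
/-- `θ (p q p⁻¹) = θ(p)⁻¹ θ(q) θ(p)` for a unit `p`. [cite: Weyl1939, Ch. II §10] -/
theorem antiHom_conj {p q : R} (hp : IsUnit p) :
    θ (p * q * Ring.inverse p) = Ring.inverse (θ p) * θ q * θ p := by
  rw [hθm, hθm, antiHom_ringInverse θ hθm hθ1 hp, mul_assoc]

/-- `c(x) · c(−x) = 1`: `(1 − x)(1 + x)⁻¹ · (1 + x)(1 − x)⁻¹ = 1`. [cite: Weyl1939, Ch. II §10] -/
theorem cayley_mul_cayley_neg {x : R} (hp : IsUnit (1 + x)) (hm : IsUnit (1 - x)) :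
    cayley x * cayley (-x) = 1 := by
  rw [cayley_def, cayley_def, sub_neg_eq_add, ← sub_eq_add_neg, mul_assoc, ← mul_assoc (Ring.inverse (1 + x)),
    Ring.inverse_mul_cancel _ hp, one_mul, Ring.mul_inverse_cancel _ hm]

/-- `c(−x) · c(x) = 1`. [cite: Weyl1939, Ch. II §10] -/
theorem cayley_neg_mul_cayley {x : R} (hp : IsUnit (1 + x)) (hm : IsUnit (1 - x)) :
    cayley (-x) * cayley x = 1 := by
  rw [cayley_def, cayley_def, sub_neg_eq_add, ← sub_eq_add_neg, mul_assoc, ← mul_assoc (Ring.inverse (1 - x)),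
    Ring.inverse_mul_cancel _ hm, one_mul, Ring.mul_inverse_cancel _ hp]

/-- **`c(x)⁻¹ = c(−x)`** (`1 ± x` units). [cite: Weyl1939, Ch. II §10] -/
theorem ringInverse_cayley {x : R} (hp : IsUnit (1 + x)) (hm : IsUnit (1 - x)) :
    Ring.inverse (cayley x) = cayley (-x) := by
  rw [show cayley x = ((⟨_, _, cayley_mul_cayley_neg hp hm, cayley_neg_mul_cayley hp hm⟩ : Rˣ) : R) from rfl,
    Ring.inverse_unit]
  rfl

/-- **`c(−x)⁻¹ = c(x)`** (`1 ± x` units). [cite: Weyl1939, Ch. II §10] -/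
theorem ringInverse_cayley_neg {x : R} (hp : IsUnit (1 + x)) (hm : IsUnit (1 - x)) :
    Ring.inverse (cayley (-x)) = cayley x := by
  rw [show cayley (-x) = ((⟨_, _, cayley_neg_mul_cayley hp hm, cayley_mul_cayley_neg hp hm⟩ : Rˣ) : R) from rfl,
    Ring.inverse_unit]
  rfl

/-- The Cayley transform of `x` commutes with everything that commutes with `x` (torus rider (t1): for `Y` in the
commutant of `γ`, `c(Y)` commutes with `γ`). [cite: Weyl1939, Ch. II §10] -/
theorem commute_cayley {a x : R} (h : Commute a x) (hp : IsUnit (1 + x)) : Commute a (cayley x) := by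
  obtain ⟨u, hu⟩ := hp
  have hu' : Commute a (u : R) := by rw [hu]; exact (Commute.one_right a).add_right h
  rw [cayley_def, ← hu, Ring.inverse_unit]
  exact ((Commute.one_right a).sub_right h).mul_right hu'.units_inv_right

include hθm hθ1 in
/-- **`θ(c x) = c(θ x)`** for an ADDITIVE anti-homomorphism `θ`: `θ((1 − x)(1 + x)⁻¹) = (1 + θx)⁻¹(1 − θx) = c(θ x)`
(`1 + x` a unit). [cite: Weyl1939, Ch. II §10] -/
theorem antiHom_cayley (hθa : ∀ x y, θ (x + y) = θ x + θ y) (hθs : ∀ x y, θ (x - y) = θ x - θ y) {x : R}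
    (hp : IsUnit (1 + x)) : θ (cayley x) = cayley (θ x) := by
  have hp' : IsUnit (1 + θ x) := by
    have := isUnit_map_of_antiHom θ hθm hθ1 hp; rwa [hθa, hθ1] at this
  rw [cayley_def, hθm, antiHom_ringInverse θ hθm hθ1 hp, hθa, hθs, hθ1, cayley_eq_inverse_mul hp']

include hθm hθ1 in
/-- **`θ x = −x ⇒ θ(c x) · c x = 1`**: the Cayley transform sends the `(−1)`-eigenspace of `θ` into the «unitary
group» `{g ∣ θ g · g = 1}` (wherever `1 ± x` are units). [cite: Weyl1939, Ch. II §10] -/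
theorem antiHom_cayley_mul_cayley (hθa : ∀ x y, θ (x + y) = θ x + θ y) (hθs : ∀ x y, θ (x - y) = θ x - θ y)
    {x : R} (hx : θ x = -x) (hp : IsUnit (1 + x)) (hm : IsUnit (1 - x)) : θ (cayley x) * cayley x = 1 := by
  rw [antiHom_cayley θ hθm hθ1 hθa hθs hp, hx]
  exact cayley_neg_mul_cayley hp hm

include hθm hθ1 in
/-- **(⇐) of the unitary restriction.** If `θ x = −x`, `θ y = −y` and `θ γ = γ'` with `γ' γ = 1` (i.e. `x, y ∈ 𝔲`,
`γ ∈ U`), then `g := c(x) · γ c(y) · c(x)⁻¹` satisfies `θ(g) · g = 1` (`1 ± x`, `1 ± y` units).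
[cite: Weyl1939, Ch. II §10] -/
theorem antiHom_cayleyConj_mul_self (hθa : ∀ x y, θ (x + y) = θ x + θ y) (hθs : ∀ x y, θ (x - y) = θ x - θ y)
    {γ γ' x y : R} (hγ : θ γ = γ') (hγ'γ : γ' * γ = 1) (hx : θ x = -x) (hy : θ y = -y)
    (hxp : IsUnit (1 + x)) (hxm : IsUnit (1 - x)) (hyp : IsUnit (1 + y)) (hym : IsUnit (1 - y)) :
    θ (cayley x * (γ * cayley y) * Ring.inverse (cayley x)) * (cayley x * (γ * cayley y) * Ring.inverse (cayley x))
      = 1 := by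
  rw [antiHom_conj θ hθm hθ1 (isUnit_cayley hxp hxm), antiHom_cayley θ hθm hθ1 hθa hθs hxp, hθm γ (cayley y),
    antiHom_cayley θ hθm hθ1 hθa hθs hyp, hx, hy, hγ, ringInverse_cayley_neg hxp hxm, ringInverse_cayley hxp hxm]
  have h1 : ∀ W : R, cayley (-x) * (cayley x * W) = W := fun W => by
    rw [← mul_assoc, cayley_neg_mul_cayley hxp hxm, one_mul]
  have h2 : ∀ W : R, γ' * (γ * W) = W := fun W => by rw [← mul_assoc, hγ'γ, one_mul]
  have h3 : ∀ W : R, cayley (-y) * (cayley y * W) = W := fun W => by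
    rw [← mul_assoc, cayley_neg_mul_cayley hyp hym, one_mul]
  simp only [mul_assoc, h1, h2, h3]
  exact cayley_mul_cayley_neg hxp hxm

include hθm hθ1 in
/-- **(⇒) of the unitary restriction.** If `g := c(x) · γ c(y) · c(x)⁻¹` satisfies `θ(g) · g = 1` (`θ γ = γ'`,
`γ γ' = 1`; `1 ± x`, `1 + y`, `1 ± θx`, `1 ± θy` units), then `g` is ALSO the chart value at the reflected parameters
`(−θ x, −θ y)`: `c(−θx) · γ c(−θy) · c(−θx)⁻¹ = g` — so injectivity of the chart forces `θ x = −x`, `θ y = −y`.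
[cite: Weyl1939, Ch. II §10] -/
theorem cayleyConj_antiHom_eq_of_mul_self (hθa : ∀ x y, θ (x + y) = θ x + θ y)
    (hθs : ∀ x y, θ (x - y) = θ x - θ y) {γ γ' x y : R} (hγ : θ γ = γ') (hγγ' : γ * γ' = 1)
    (hxp : IsUnit (1 + x)) (hxm : IsUnit (1 - x)) (hyp : IsUnit (1 + y))
    (hap : IsUnit (1 + θ x)) (ham : IsUnit (1 - θ x)) (hbp : IsUnit (1 + θ y)) (hbm : IsUnit (1 - θ y))
    (h : θ (cayley x * (γ * cayley y) * Ring.inverse (cayley x)) *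
      (cayley x * (γ * cayley y) * Ring.inverse (cayley x)) = 1) :
    cayley (-θ x) * (γ * cayley (-θ y)) * Ring.inverse (cayley (-θ x)) =
      cayley x * (γ * cayley y) * Ring.inverse (cayley x) := by
  -- `P' · θ(P) = 1`, whence `P' = P' (θP · P) = (P' θP) P = P`.
  set P := cayley x * (γ * cayley y) * Ring.inverse (cayley x) with hP
  have hQ : θ P = Ring.inverse (cayley (θ x)) * (cayley (θ y) * γ') * cayley (θ x) := by
    rw [hP, antiHom_conj θ hθm hθ1 (isUnit_cayley hxp hxm), antiHom_cayley θ hθm hθ1 hθa hθs hxp, hθm γ (cayley y),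
      antiHom_cayley θ hθm hθ1 hθa hθs hyp, hγ]
  have key : cayley (-θ x) * (γ * cayley (-θ y)) * Ring.inverse (cayley (-θ x)) * θ P = 1 := by
    rw [hQ, ringInverse_cayley_neg hap ham]
    have h1 : ∀ W : R, cayley (θ x) * (Ring.inverse (cayley (θ x)) * W) = W :=
      fun W => Ring.mul_inverse_cancel_left _ _ (isUnit_cayley hap ham)
    have h2 : ∀ W : R, γ * (γ' * W) = W := fun W => by rw [← mul_assoc, hγγ', one_mul]
    have h3 : ∀ W : R, cayley (-θ y) * (cayley (θ y) * W) = W := fun W => by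
      rw [← mul_assoc, cayley_neg_mul_cayley hbp hbm, one_mul]
    simp only [mul_assoc, h1, h2, h3]
    exact cayley_neg_mul_cayley hap ham
  calc _ = cayley (-θ x) * (γ * cayley (-θ y)) * Ring.inverse (cayley (-θ x)) * (θ P * P) := by rw [h, mul_one]
    _ = P := by rw [← mul_assoc, key, one_mul]

end Ring

/-! ### 2. The form adjoint `θ_J X = J⁻¹ σ(X)ᵀ J` and `U(σ, J)` -/

section FormAdjoint

open Literature.NumberTheory.Automorphic Literature.Analysis.Calculus

variable {E : Type*} [CommRing E] {n : Type*} [Fintype n] [DecidableEq n] (σ : E →+* E) {J : Matrix n n E}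

/-- `θ_J (X Y) = θ_J Y · θ_J X`. [cite: PlatonovRapinchuk1994, §2.3] -/
theorem formAdjoint_mul (hJ : IsUnit J.det) (X Y : Matrix n n E) :
    J⁻¹ * ((X * Y).map σ)ᵀ * J = (J⁻¹ * (Y.map σ)ᵀ * J) * (J⁻¹ * (X.map σ)ᵀ * J) := by
  rw [Matrix.map_mul, Matrix.transpose_mul]
  simp only [Matrix.mul_assoc]
  rw [Matrix.mul_nonsing_inv_cancel_left J _ hJ]

/-- `θ_J 1 = 1`. [cite: PlatonovRapinchuk1994, §2.3] -/
theorem formAdjoint_one (hJ : IsUnit J.det) : J⁻¹ * ((1 : Matrix n n E).map σ)ᵀ * J = 1 := by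
  rw [Matrix.map_one σ (map_zero σ) (map_one σ), Matrix.transpose_one, Matrix.mul_one, Matrix.nonsing_inv_mul J hJ]

/-- `θ_J (X + Y) = θ_J X + θ_J Y`. [cite: PlatonovRapinchuk1994, §2.3] -/
theorem formAdjoint_add (X Y : Matrix n n E) :
    J⁻¹ * ((X + Y).map σ)ᵀ * J = J⁻¹ * (X.map σ)ᵀ * J + J⁻¹ * (Y.map σ)ᵀ * J := by
  rw [Matrix.map_add σ (map_add σ), Matrix.transpose_add, Matrix.mul_add, Matrix.add_mul]

/-- `θ_J (X − Y) = θ_J X − θ_J Y`. [cite: PlatonovRapinchuk1994, §2.3] -/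
theorem formAdjoint_sub (X Y : Matrix n n E) :
    J⁻¹ * ((X - Y).map σ)ᵀ * J = J⁻¹ * (X.map σ)ᵀ * J - J⁻¹ * (Y.map σ)ᵀ * J := by
  rw [Matrix.map_sub σ (map_sub σ), Matrix.transpose_sub, Matrix.mul_sub, Matrix.sub_mul]

/-- **`g ∈ U(σ, J) ↔ θ_J g · g = 1`** (`J` with unit determinant). [cite: PlatonovRapinchuk1994, §2.3] -/
theorem mem_unitaryGroupOfForm_iff_formAdjoint_mul_eq_one (hJ : IsUnit J.det) (g : GL n E) :
    g ∈ unitaryGroupOfForm σ J ↔ J⁻¹ * ((g : Matrix n n E).map σ)ᵀ * J * (g : Matrix n n E) = 1 := by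
  rw [mem_unitaryGroupOfForm_iff]
  constructor
  · intro h
    rw [show J⁻¹ * ((g : Matrix n n E).map σ)ᵀ * J * (g : Matrix n n E) =
        J⁻¹ * (((g : Matrix n n E).map σ)ᵀ * J * (g : Matrix n n E)) by simp only [Matrix.mul_assoc], h,
      Matrix.nonsing_inv_mul J hJ]
  · intro h
    have h2 := congrArg (fun X => J * X) h
    simpa only [← Matrix.mul_assoc, Matrix.mul_nonsing_inv J hJ, Matrix.one_mul, Matrix.mul_one] using h2

/-- **`θ_J W · W = 1 ⇒ W ∈ U(σ, J)`** for a bare matrix `W` (it is then invertible, `W · θ_J W = 1` by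
`mul_eq_one_comm`). [cite: PlatonovRapinchuk1994, §2.3] -/
theorem exists_mem_unitaryGroupOfForm_coe_eq (hJ : IsUnit J.det) {W : Matrix n n E}
    (h : J⁻¹ * (W.map σ)ᵀ * J * W = 1) : ∃ g ∈ unitaryGroupOfForm σ J, (g : Matrix n n E) = W := by
  refine ⟨⟨W, J⁻¹ * (W.map σ)ᵀ * J, mul_eq_one_comm.1 h, h⟩, ?_, rfl⟩
  rw [mem_unitaryGroupOfForm_iff_formAdjoint_mul_eq_one σ hJ]
  exact h

/-- **`θ_J γ = γ⁻¹` for `γ ∈ U(σ, J)`.** [cite: PlatonovRapinchuk1994, §2.3] -/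
theorem formAdjoint_coe_eq_coe_inv (hJ : IsUnit J.det) {γ : GL n E} (hγ : γ ∈ unitaryGroupOfForm σ J) :
    J⁻¹ * ((γ : Matrix n n E).map σ)ᵀ * J = ((γ⁻¹ : GL n E) : Matrix n n E) := by
  have h := (mem_unitaryGroupOfForm_iff_formAdjoint_mul_eq_one σ hJ γ).1 hγ
  calc J⁻¹ * ((γ : Matrix n n E).map σ)ᵀ * J
        = J⁻¹ * ((γ : Matrix n n E).map σ)ᵀ * J * ((γ : Matrix n n E) * ((γ⁻¹ : GL n E) : Matrix n n E)) := by
          rw [← Units.val_mul, mul_inv_cancel, Units.val_one, Matrix.mul_one]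
    _ = ((γ⁻¹ : GL n E) : Matrix n n E) := by rw [← Matrix.mul_assoc, h, Matrix.one_mul]

/-- **`θ_J` of a commutator with a unitary `γ`:** `θ_J(γX − Xγ) = γ⁻¹ · (γ·θ_J X − θ_J X·γ) · γ⁻¹`.
[cite: PlatonovRapinchuk1994, §2.3] -/
theorem formAdjoint_commutator_of_mem (hJ : IsUnit J.det) {γ : GL n E} (hγ : γ ∈ unitaryGroupOfForm σ J)
    (X : Matrix n n E) :
    J⁻¹ * (((γ : Matrix n n E) * X - X * (γ : Matrix n n E)).map σ)ᵀ * J =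
      ((γ⁻¹ : GL n E) : Matrix n n E) *
        ((γ : Matrix n n E) * (J⁻¹ * (X.map σ)ᵀ * J) - (J⁻¹ * (X.map σ)ᵀ * J) * (γ : Matrix n n E)) *
        ((γ⁻¹ : GL n E) : Matrix n n E) := by
  rw [formAdjoint_sub, formAdjoint_mul σ hJ, formAdjoint_mul σ hJ, formAdjoint_coe_eq_coe_inv σ hJ hγ,
    Matrix.mul_sub, Matrix.sub_mul, ← Matrix.mul_assoc ((γ⁻¹ : GL n E) : Matrix n n E) (γ : Matrix n n E),
    ← Units.val_mul, inv_mul_cancel, Units.val_one, Matrix.one_mul]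
  simp only [Matrix.mul_assoc, ← Units.val_mul, mul_inv_cancel, Units.val_one, Matrix.mul_one]

/-- **`θ_J` preserves the commutant of a unitary `γ`:** `γX = Xγ ⇒ γ·θ_J X = θ_J X·γ` (stated on the kernel of
`ad γ = L_γ − R_γ`). [cite: PlatonovRapinchuk1994, §2.3] -/
theorem formAdjoint_mem_ker_ad (hJ : IsUnit J.det) {γ : GL n E} (hγ : γ ∈ unitaryGroupOfForm σ J)
    {X : Matrix n n E}
    (hX : X ∈ LinearMap.ker (LinearMap.mulLeft E (γ : Matrix n n E) - LinearMap.mulRight E (γ : Matrix n n E))) :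
    J⁻¹ * (X.map σ)ᵀ * J ∈
      LinearMap.ker (LinearMap.mulLeft E (γ : Matrix n n E) - LinearMap.mulRight E (γ : Matrix n n E)) := by
  simp only [LinearMap.mem_ker, LinearMap.sub_apply, LinearMap.mulLeft_apply, LinearMap.mulRight_apply] at hX ⊢
  have h := formAdjoint_commutator_of_mem σ hJ hγ X
  rw [hX, Matrix.map_zero σ (map_zero σ), Matrix.transpose_zero, Matrix.mul_zero, Matrix.zero_mul] at h
  have h2 := congrArg (fun Y => (γ : Matrix n n E) * Y * (γ : Matrix n n E)) h.symm
  simpa only [Matrix.mul_zero, Matrix.zero_mul, ← Matrix.mul_assoc, ← Units.val_mul, mul_inv_cancel, Units.val_one,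
    Matrix.one_mul, Matrix.mul_assoc _ ((γ⁻¹ : GL n E) : Matrix n n E) (γ : Matrix n n E), inv_mul_cancel,
    Matrix.mul_one] using h2

/-- **`θ_J` preserves the slice `range (ad γ)` of a unitary `γ`:** `θ_J(γZ − Zγ) = γ W − W γ` with
`W = γ⁻¹ θ_J(Z) γ⁻¹`. [cite: PlatonovRapinchuk1994, §2.3] -/
theorem formAdjoint_mem_range_ad (hJ : IsUnit J.det) {γ : GL n E} (hγ : γ ∈ unitaryGroupOfForm σ J)
    {X : Matrix n n E}
    (hX : X ∈ LinearMap.range (LinearMap.mulLeft E (γ : Matrix n n E) - LinearMap.mulRight E (γ : Matrix n n E))) :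
    J⁻¹ * (X.map σ)ᵀ * J ∈
      LinearMap.range (LinearMap.mulLeft E (γ : Matrix n n E) - LinearMap.mulRight E (γ : Matrix n n E)) := by
  obtain ⟨Z, rfl⟩ := hX
  refine ⟨((γ⁻¹ : GL n E) : Matrix n n E) * (J⁻¹ * (Z.map σ)ᵀ * J) * ((γ⁻¹ : GL n E) : Matrix n n E), ?_⟩
  simp only [LinearMap.sub_apply, LinearMap.mulLeft_apply, LinearMap.mulRight_apply]
  rw [formAdjoint_commutator_of_mem σ hJ hγ, Matrix.mul_sub, Matrix.sub_mul]
  simp only [← Matrix.mul_assoc, ← Units.val_mul, mul_inv_cancel, inv_mul_cancel, Units.val_one, Matrix.one_mul]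
  simp only [Matrix.mul_assoc, ← Units.val_mul, mul_inv_cancel, inv_mul_cancel, Units.val_one, Matrix.mul_one]

/-- **The Cayley transform lands in the unitary group:** `θ_J X = −X` and `1 ± X` units ⇒
`c(X) = (1 − X)(1 + X)⁻¹ ∈ U(σ, J)` (the tree's general `unitaryGroupOfForm`; cf. ★ `UnitaryGroup.cayley_mem_arch`
for the archimedean `arch`). [cite: Weyl1939, Ch. II §10] [cite: PlatonovRapinchuk1994, §2.3] -/
theorem cayley_mem_unitaryGroupOfForm (hJ : IsUnit J.det) {X : Matrix n n E}
    (hX : J⁻¹ * (X.map σ)ᵀ * J = -X) (hp : IsUnit (1 + X)) (hm : IsUnit (1 - X)) :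
    ∃ g ∈ unitaryGroupOfForm σ J, (g : Matrix n n E) = cayley X := by
  refine ⟨(isUnit_cayley hp hm).unit, ?_, (isUnit_cayley hp hm).unit_spec⟩
  rw [mem_unitaryGroupOfForm_iff_formAdjoint_mul_eq_one σ hJ, (isUnit_cayley hp hm).unit_spec]
  exact antiHom_cayley_mul_cayley (fun Y => J⁻¹ * (Y.map σ)ᵀ * J) (formAdjoint_mul σ hJ) (formAdjoint_one σ hJ)
    (formAdjoint_add σ) (formAdjoint_sub σ) hX hp hm

end FormAdjoint

end Literature.LinearAlgebra.Matrix
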